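import Literature.MathematicalPhysics.QuantumFieldTheory.Balaban1983to89.B9Thm39CinvSumsY

/-!
# `Balaban1983to89.B9Thm39CinvSumsYLoc` — [Balaban1985BackgroundPropagators] (3.95)/(3.97) pp. 411–412 AT def-Y's BLOCK CARRIER WITH THE PRINTED
# LOCALIZATIONS: the three sums of `R` and the (3.96) glue re-run with the cube letters' (3.48) blocks UN-localized and the [2]-difference of (3.97)
# LOCALIZED to `□̃`-rows × `S_□`-columns (cell `lit-balaban`, G-B9-LETTERS module M5.6 FILE 9a, seat p21 gen 33 — the displayed-input repair of M5.6)

statement-level skeleton of published theorems with citation tags; proofs where landed; nothing here is a claim about the Yang–Mills mass gap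

CITATION HEADER (lean-in-tree rule).  B9 = T. Bałaban, *Propagators for lattice gauge theories in a background field*, Commun. Math. Phys. **99** (1985)
389–434 (journal page = PDF page + 388; held `paper:balaban1985-cmp99-background-propagators`, pp. 408–413 re-read by this seat 2026-08-28 on the page
renders `…-p020/p023/p024-x2.png`).  p. 411 (3.95) «Q′G′²Q′*C₀ = I + Σ_□(1 − □̃)Q′G′²Q′*h_□C_□h_□ + Σ_□ □̃Q′(G′² − G′²_□)Q′*h_□C_□h_□ + Σ_□[□̃Q′G′²_□Q′*, h_□]C_□h_□
= I − R.  By the same estimates as in [4], especially (2.83)–(2.85), we can see that the operator R is small»; p. 411 «The characteristic function 1 − □̃ at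
the beginning of the term, and the function h_□ at the end, restrict a kernel of the term to points separated at least by a distance MLʲη»; p. 412 (3.97)
«the usual factors multiplied by e^{−2δ₀M}», «terms in the third sum … are already localized and give small factors O(M⁻¹)»; p. 409 (3.87) «C₀ = Σ h_□C_□h_□»,
«G′_□(U), C_□(U) = (Q′(U)G′²_□(U)Q′*(U))⁻¹, G_□(U), satisfy all the inequalities of Theorems 3.1–3.3»; p. 398 Thm 3.2 (3.48).  [4] = [Balaban1984PropagatorsII]:
(2.51)–(2.54) pp. 232–233, (2.61)/(2.66) p. 234, (2.83)–(2.85) pp. 237–238.  Rows B9.Eq3.95 × B9.Eq3.97 × B9.Thm3.9 × B9.Thm3.2 (cells only; no row head changes).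

WHY THIS FILE (self-audit of the module's end-to-end statement, FILES 6/8 = `B9Thm39CinvTorusRegularFinal` / `B9Thm39CinvOfEBlock`).  Two of their DISPLAYED
per-cube inputs were typed stronger than print and than the genuine letters allow, although every proof only used the weaker printed content:
(D1) `hC` asked the (3.48) block of `conj b (s•C_□)` LOCALIZED to the set `S_□` that also carries `supp h_□` and is separated from `(□̃)ᶜ` — but a genuine
`C_□` has rows on its whole domain `Ω(□) ⊋ □̃`; every use (FILE 1 §4, FILE 5b) dominated the indicator away and re-localized by the `h_□`-sandwich.
(D2) `hD` asked the [2]-difference `conj b (s′•(L − L_□))`, `L = Q′G′²Q′*`, UNIFORMLY `e^{−2δ₀D}`-small in all rows — but outside `Ω(□)` the difference is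
`L` itself; print's (3.95)/(3.97) only concern `□̃Q′(G′² − G′²_□)Q′*h_□`, rows in `□̃` and columns in `supp h_□`, and FILE 5a's `term397_majorant_blk` takes
the difference as an ABSTRACT letter `D`.  THIS FILE re-runs FILE 5b's three sums and FILE 1 §4's glue with (i) `hC` UN-localized, `B₀P(a)e^{−bδ₀d(a,a′)}`
for all `a, a′` (the printed (3.48) shape of Cor. 3.6 for `C_□`), and (ii) `hD` on the LOCALIZED word `M_{1_{S^χ_□}}·(L − L_□)·M_{1_{S_□}}` read through
`conj b` — with the one extra printed fact `supp χ_□ ⊂ S^χ_□` (`χ_□ = □̃` IS a characteristic function).  Same constants, same rates, same r06/FILE-2/FILE-5a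
estimates BY NAME; FILES 1–8 are untouched (append-only repair; FILE 9b re-assembles, FILE 10 instantiates at the cube cover of record).

WHAT IS PROVED (all `theorem`s, 0 `def`, 0 sorry, 0 new named facts).
* §1 algebra: `mulOp_mul_mulOp_of_eq_one` / `mulOp_mulOp_mul_of_eq_one` (a cut-off equal to 1 on the support of another is absorbed), `conj_cut_sandwich`
  (`conj b (s′•(M_f·W·M_g)) = mulOp f·conj b (s′•W)·mulOp g`), `term2_word_loc` (the □-term of the second sum with the two characteristic cut-offs inserted:
  `mulOp χ·W·(M_hC M_h) = mulOp χ·(M_{1_{S^χ}}W M_{1_S})·(M_hC M_h)` when `supp χ ⊂ S^χ`, `supp h ⊂ S`).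
* §2 ★★ `hR₁_of_cubes'`, ★★ `hR₂_of_cubes_loc`, ★★ `hR₃_of_cubes'` — FILE 1's three displayed sum majorants with the SAME constants
  `θ₁ = NκB₀Cc₁(δ₀,b−ρ)e^{−a_sepδ₀D_sep}`, `θ₂ = Nκ_De^{−2δ₀D_sep}B₀Cc₁(δ₀,b−ρ)`, `θ₃ = N(ℓ₀ + ℓ₁(α_cδ₀)⁻¹)κB₀Cc₁(δ₀,b−ρ)` from the un-localized `hC` and (for
  the second sum) the localized `hD`.
* §3 ★★ `hasMajorant_conj_Cinv_of_cubes'` — FILE 1 §4 with the un-localized `hC`.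

HONEST SCOPE / NOT CLAIMED.  Bookkeeping repair only: no new analytic content; the per-cube (3.48) blocks `hC` (Cor. 3.6 for the cube letters — M5.2-E), the
localized [2]-difference `hD` (cell GAPS G-B9-05 — the estimate itself is NOT derived in the tree; only its displayed SHAPE is now the printed one), `hL`/`hLloc`,
the cut-off data and the geometry remain displayed.  Finite 𝕋 member of the k-level V1 family; constants explicit; nothing continuum, nothing about the mass gap;
NOT summit progress.  RELATED, NOT DUPLICATED: FILE 5b `B9Thm39CinvSumsY` (localized-`hC` / global-`hD` versions, kept for their consumers FILE 6/8),
FILE 1 `B9Thm39CinvTorusRegular` §4, r06's scalar `B9Thm39Whole`.  Searched 2026-08-28: `lean search 'hR2_of_cubes_loc|Cinv_of_cubes' --decl` = ∅.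
-/

noncomputable section

namespace Literature.MathematicalPhysics.QuantumFieldTheory.Balaban1983to89.B9Thm39CinvSumsYLoc

open Node00
open B6KLevelCensusIndexV1 (KIdx)
open B6RandomWalk (HasMajorant Triangle254 Ineq261 Ineq263 hasMajorant_mono)
open B9Thm34Ext (toB6)
open B9GeoNormsKLevelV1 (geo9K)
open B9Eq352DivFormLetters (conj conj_sub conj_neg)
open B9Thm37Sum (mulOp mulOp_apply)
open B9Thm37CubeCoverCommutators (cutMulY)
open B9Thm37GpTorusRegular (conj_one conj_sum conj_smul)
open B9Thm39CinvTorusRegular (conj_cutMulY hasMajorant_conj_C0_of_cubes hasMajorant_conj_Cinv_of_395 hasMajorant_three)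
open B9Thm39CinvSumsY (conj_term1 conj_term2 conj_term3 mul_eq_smul_mul_smul)
open B9Thm39Sum (hasMajorant_sandwich_local₂)
open B9Ineq368PPrime (hasMajorant_neg)
open B9Eq395Small (mulOp_mul_mulOp)

variable {d ℓ : ℕ} {hd : 1 ≤ d + 1} {hL : Odd (ℓ + 1) ∧ 1 < ℓ + 1} {b₀ b₁ : ℝ}
variable {𝔸 : Type} [NormedRing 𝔸] [NormedAlgebra ℂ 𝔸] [CompleteSpace 𝔸]
variable {ι : Type} [Fintype ι]
variable (i : KIdx d ℓ hd hL b₀ b₁) (b : Module.Basis ι ℝ 𝔸)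

/-! ## §1 Algebra: absorbing characteristic cut-offs, and the □-term of the second sum with the printed localizations inserted -/

section Algebra

variable {X S : Type}

/-- a cut-off `g` equal to `1` wherever `f ≠ 0` is absorbed on the right: `M_f·M_g = M_f`. [cite: Balaban1985BackgroundPropagators, (3.95) p.411 (□̃h_□ = h_□), bookkeeping] -/
theorem mulOp_mul_mulOp_of_eq_one (f g : X → ℝ) (hfg : ∀ x, f x ≠ 0 → g x = 1) : mulOp f * mulOp g = mulOp f := by
  rw [mulOp_mul_mulOp]
  congr 1
  funext x
  by_cases hx : f x = 0
  · rw [hx, zero_mul]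
  · rw [hfg x hx, mul_one]

/-- … and on the left: `M_g·M_f = M_f`. [cite: Balaban1985BackgroundPropagators, (3.95) p.411, bookkeeping] -/
theorem mulOp_mulOp_mul_of_eq_one (f g : X → ℝ) (hfg : ∀ x, f x ≠ 0 → g x = 1) : mulOp g * mulOp f = mulOp f := by
  rw [mulOp_mul_mulOp]
  congr 1
  funext x
  by_cases hx : f x = 0
  · rw [hx, mul_zero]
  · rw [hfg x hx, one_mul]

omit [CompleteSpace 𝔸] in
/-- **two (different) real cut-offs around a letter, in real coordinates**: `conj b (s′•(M_f·W·M_g)) = mulOp f·conj b (s′•W)·mulOp g` (FILE 5b's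
`conj_smul_sandwich` with `f ≠ g`). [cite: Balaban1985BackgroundPropagators, (3.95) p.411; Balaban1984PropagatorsII, (2.52) p.232, bookkeeping] -/
theorem conj_cut_sandwich (s' : ℝ) (f g : S → ℝ) (W : Module.End ℝ (S → 𝔸)) :
    conj b (s' • ((cutMulY (𝔸 := 𝔸) f).restrictScalars ℝ * W * (cutMulY (𝔸 := 𝔸) g).restrictScalars ℝ)) =
      mulOp (fun p : S × ι => f p.1) * conj b (s' • W) * mulOp (fun p : S × ι => g p.1) := by
  rw [show s' • ((cutMulY (𝔸 := 𝔸) f).restrictScalars ℝ * W * (cutMulY (𝔸 := 𝔸) g).restrictScalars ℝ) =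
      (cutMulY (𝔸 := 𝔸) f).restrictScalars ℝ * (s' • W) * (cutMulY (𝔸 := 𝔸) g).restrictScalars ℝ by
    rw [mul_smul_comm, smul_mul_assoc]]
  rw [B9Eq352DivFormLetters.conj_mul, B9Eq352DivFormLetters.conj_mul, conj_cutMulY, conj_cutMulY]

/-- **the □-term of the second sum with print's two characteristic localizations inserted**: if `gχ = 1` on `supp χ` and `gS = 1` on `supp h`, then
`mulOp χ·W·(M_h·C·M_h) = mulOp χ·(mulOp gχ·W·mulOp gS)·(M_h·C·M_h)` — the difference letter of (3.97) is only read between `□̃`-rows and `S_□`-columns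
(«□̃ … at the beginning of the term, and the function h_□ at the end, restrict a kernel of the term»). [cite: Balaban1985BackgroundPropagators, (3.95) p.411 + (3.97) p.412] -/
theorem term2_word_loc (χ h gχ gS : X → ℝ) (W C : Module.End ℝ (X → ℝ))
    (hχ : ∀ x, χ x ≠ 0 → gχ x = 1) (hh : ∀ x, h x ≠ 0 → gS x = 1) :
    mulOp χ * W * (mulOp h * C * mulOp h) = mulOp χ * (mulOp gχ * W * mulOp gS) * (mulOp h * C * mulOp h) := by
  calc mulOp χ * W * (mulOp h * C * mulOp h)
      = (mulOp χ * mulOp gχ) * W * ((mulOp gS * mulOp h) * C * mulOp h) := by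
        rw [mulOp_mul_mulOp_of_eq_one χ gχ hχ, mulOp_mulOp_mul_of_eq_one h gS hh]
    _ = mulOp χ * (mulOp gχ * W * mulOp gS) * (mulOp h * C * mulOp h) := by noncomm_ring

end Algebra

/-! ## §2 ★★ The three sums of (3.95) from the un-localized `hC` and the localized `hD` -/

section Sums

variable [DecidableEq ι] [Fintype (geo9K i).Site] [DecidableEq (geo9K i).Site] {Rr : ℝ} {Hp : Prop}
variable (ιB : BlkY i → IBondY i)

omit [CompleteSpace 𝔸] [DecidableEq ι] in
/-- ★★ **THE FIRST SUM OF (3.95) IS (2.85)-SMALL — FILE 1's `hR₁`, from the UN-localized (3.48) blocks of the `C_□`** («The characteristic function 1 − □̃ at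
the beginning of the term, and the function h_□ at the end, restrict a kernel of the term to points separated at least by a distance MLʲη»): as FILE 5b's
`hR₁_of_cubes`, with `hC : conj b (s•C_□) ≺ B₀P(a)e^{−bδ₀d(a,a′)}` for all `a, a′` (the localization to `S_□ × S_□` comes from the `h_□`-sandwich, `supp h_□ ⊂ S_□`):
majorant `θ₁e^{−ρδ₀d}`, `θ₁ = N·κB₀Cc₁(δ₀, b−ρ)e^{−a_sepδ₀D_sep}`. [cite: Balaban1985BackgroundPropagators, (3.95) p.411; Balaban1984PropagatorsII, (2.83)–(2.85) pp.237–238] -/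
theorem hR₁_of_cubes' (d' : ℕ) {δ₀ aL αst asep ρ bb κ B₀ C Dsep N s s' : ℝ} (P : (geo9K i).Site → ℝ)
    {κι : Type} [Fintype κι] (Sχ S : κι → Finset (geo9K i).Site) (χ h : κι → BlkY i → ℝ)
    {L : Module.End ℝ (BlkY i → 𝔸)} (Cl : κι → Module.End ℝ (BlkY i → 𝔸))
    (hs : s' * s = 1) (hκ : 0 ≤ κ) (hB₀ : 0 ≤ B₀) (hC0 : 0 ≤ C) (hP : ∀ a, 0 < P a) (hδ₀ : 0 ≤ δ₀)
    (hasep : 0 ≤ asep) (hρ : 0 ≤ ρ) (hsplit : αst + asep + ρ ≤ aL)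
    (htri : Triangle254 (toB6 (geo9K i) Rr Hp)) (hsymm : ∀ a a' : (geo9K i).Site, (geo9K i).dist a a' = (geo9K i).dist a' a)
    (hdnn : ∀ a a' : (geo9K i).Site, 0 ≤ (geo9K i).dist a a')
    (hST : B9Ineq347.ScaleTransfer (geo9K i) δ₀ αst C P) (h261 : Ineq261 d' (toB6 (geo9K i) Rr Hp) δ₀ (bb - ρ))
    (hχ01 : ∀ k t, 0 ≤ χ k t ∧ χ k t ≤ 1) (hχS : ∀ k t, ιB t ∈ Sχ k → χ k t = 1)
    (hh : ∀ k t, |h k t| ≤ 1) (hS : ∀ k t, h k t ≠ 0 → ιB t ∈ S k)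
    (hsep : ∀ k a, a ∉ Sχ k → ∀ a'' ∈ S k, Dsep ≤ (geo9K i).dist a a'')
    (hcnt : ∀ a : (geo9K i).Site, (∑ k, if a ∈ S k then (1 : ℝ) else 0) ≤ N)
    (hLmaj : HasMajorant (g := toB6 (geo9K i) Rr Hp) (fun p : BlkY i × ι => ιB p.1) (conj b (s' • L))
      (fun a a'' => κ * (P a)⁻¹ * Real.exp (-(aL * δ₀ * (geo9K i).dist a a''))))
    (hC : ∀ k, HasMajorant (g := toB6 (geo9K i) Rr Hp) (fun p : BlkY i × ι => ιB p.1) (conj b (s • Cl k))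
      (fun a a' => B₀ * P a * Real.exp (-(bb * δ₀ * (geo9K i).dist a a')))) :
    HasMajorant (g := toB6 (geo9K i) Rr Hp) (fun p : BlkY i × ι => ιB p.1)
      (conj b (-(∑ k, (1 - (cutMulY (𝔸 := 𝔸) (χ k)).restrictScalars ℝ) * L *
        ((cutMulY (𝔸 := 𝔸) (h k)).restrictScalars ℝ * Cl k * (cutMulY (𝔸 := 𝔸) (h k)).restrictScalars ℝ))))
      (fun a a' => (N * (κ * B₀ * C * B6.c1 d' δ₀ (bb - ρ) * Real.exp (-(asep * δ₀ * Dsep)))) *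
        Real.exp (-(ρ * δ₀ * (geo9K i).dist a a'))) := by
  rw [conj_neg]
  refine hasMajorant_neg (g := geo9K i) (R := Rr) (H := Hp) _ ?_
  rw [conj_sum]
  have hterm : ∀ k, conj b ((1 - (cutMulY (𝔸 := 𝔸) (χ k)).restrictScalars ℝ) * L *
      ((cutMulY (𝔸 := 𝔸) (h k)).restrictScalars ℝ * Cl k * (cutMulY (𝔸 := 𝔸) (h k)).restrictScalars ℝ)) =
      mulOp (fun p : BlkY i × ι => 1 - χ k p.1) * conj b (s' • L) *
        (mulOp (fun p : BlkY i × ι => h k p.1) * conj b (s • Cl k) * mulOp (fun p : BlkY i × ι => h k p.1)) :=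
    fun k => conj_term1 b hs (χ k) (h k) L (Cl k)
  rw [Finset.sum_congr rfl fun k _ => hterm k]
  -- the two-sided localization of `M_h·conj b (s•C_□)·M_h` to `S_□ × S_□` comes from the sandwich alone
  have hT : ∀ k, HasMajorant (g := toB6 (geo9K i) Rr Hp) (fun p : BlkY i × ι => ιB p.1)
      (mulOp (fun p : BlkY i × ι => h k p.1) * conj b (s • Cl k) * mulOp (fun p : BlkY i × ι => h k p.1))
      (fun a'' a' => (if a'' ∈ S k then (1 : ℝ) else 0) * (if a' ∈ S k then (1 : ℝ) else 0) *
        (B₀ * P a'' * Real.exp (-(bb * δ₀ * (geo9K i).dist a'' a')))) := fun k =>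
    hasMajorant_sandwich_local₂ (R := Rr) (H := Hp) (fun p : BlkY i × ι => ιB p.1) (hC k) (fun p => h k p.1) (fun p => hh k p.1) (S k)
      (fun p hp => hS k p.1 hp)
  refine hasMajorant_mono (g := toB6 (geo9K i) Rr Hp) _
    (B9Thm39CinvFirstSum.firstSum_majorant_blk (g := geo9K i) (X := BlkY i × ι) (R := Rr) (H := Hp) (fun p : BlkY i × ι => ιB p.1) ρ δ₀
      (κ * B₀ * C * B6.c1 d' δ₀ (bb - ρ) * Real.exp (-(asep * δ₀ * Dsep))) N Sχ S
      (fun k => mulOp (fun p : BlkY i × ι => 1 - χ k p.1) * conj b (s' • L) *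
        (mulOp (fun p : BlkY i × ι => h k p.1) * conj b (s • Cl k) * mulOp (fun p : BlkY i × ι => h k p.1)))
      (mul_nonneg (mul_nonneg (mul_nonneg (mul_nonneg hκ hB₀) hC0) (B6RandomWalk.c1_nonneg d' δ₀ _)) (Real.exp_nonneg _))
      (fun k => ?_) hcnt) fun a a' => le_of_eq (by ring)
  exact B9Thm39CinvFirstSum.firstSum_term_majorant_blk (g := geo9K i) (X := BlkY i × ι) (R := Rr) (H := Hp) (fun p : BlkY i × ι => ιB p.1) d' δ₀ aL
    αst asep ρ bb κ B₀ C Dsep P (Sχ k) (S k) (fun p : BlkY i × ι => 1 - χ k p.1) hκ hB₀ hC0 hP hδ₀ hasep hρ hsplit htri hsymm hdnn hST h261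
    (fun p => by
      obtain ⟨h0, h1⟩ := hχ01 k p.1
      rw [abs_le]; constructor <;> linarith)
    (fun p hp => by rw [hχS k p.1 hp, sub_self]) (hsep k) hLmaj (hT k)

omit [CompleteSpace 𝔸] [DecidableEq ι] in
/-- ★★ **THE SECOND SUM OF (3.95) IS (2.85)-SMALL — FILE 1's `hR₂`, FROM THE LOCALIZED [2]-DIFFERENCE OF (3.97)** («Σ_□ □̃Q′(G′² − G′²_□)Q′*h_□C_□h_□»;
(3.97): «the usual factors multiplied by e^{−2δ₀M}»): with the characteristic cut-offs `χ_□` (`|χ_□| ≦ 1`, `supp χ_□ ⊂ S^χ_□` through `ιB`), the block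
cut-offs `h_□` (`|h_□| ≦ 1`, `supp h_□ ⊂ S_□`, overlap `≦ N`), the DISPLAYED majorant `hD` of the LOCALIZED difference `conj b (s′•(M_{1_{S^χ_□}}(L − L_□)M_{1_{S_□}}))`
(`κ_De^{−2δ₀D_sep}P⁻¹e^{−a_Dδ₀d}` — rows in `□̃`, columns in `S_□`; cell GAPS G-B9-05 in its printed shape), the un-localized (3.48) blocks `hC`, `s′s = 1`,
scale transfer, (2.61) at `b − ρ`, `α_st + ρ ≦ a_D`:  `conj b (−Σ_□ Chi_□·(L − L_□)·(M_{h_□}C_□M_{h_□}))` has the majorant `θ₂e^{−ρδ₀d}`,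
`θ₂ = N·κ_De^{−2δ₀D_sep}B₀Cc₁(δ₀, b−ρ)` (FILE 5a `secondSum_majorant_blk` at the localized letter `D_□ := M_{1_{S^χ_□}}·conj b (s′•(L−L_□))·M_{1_{S_□}}`).
[cite: Balaban1985BackgroundPropagators, (3.95) p.411 + (3.97) p.412; Balaban1984PropagatorsII, (2.85) p.238] -/
theorem hR₂_of_cubes_loc (d' : ℕ) {δ₀ aD αst ρ bb κD Dsep B₀ C N s s' : ℝ} (P : (geo9K i).Site → ℝ)
    {κι : Type} [Fintype κι] (Sχ S : κι → Finset (geo9K i).Site) (χ h : κι → BlkY i → ℝ)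
    {L : Module.End ℝ (BlkY i → 𝔸)} (Lloc Cl : κι → Module.End ℝ (BlkY i → 𝔸))
    (hs : s' * s = 1) (hκD : 0 ≤ κD) (hB₀ : 0 ≤ B₀) (hC0 : 0 ≤ C) (hP : ∀ a, 0 < P a) (hδ₀ : 0 ≤ δ₀) (hρ : 0 ≤ ρ) (hsplit : αst + ρ ≤ aD)
    (htri : Triangle254 (toB6 (geo9K i) Rr Hp)) (hsymm : ∀ a a' : (geo9K i).Site, (geo9K i).dist a a' = (geo9K i).dist a' a)
    (hdnn : ∀ a a' : (geo9K i).Site, 0 ≤ (geo9K i).dist a a')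
    (hST : B9Ineq347.ScaleTransfer (geo9K i) δ₀ αst C P) (h261 : Ineq261 d' (toB6 (geo9K i) Rr Hp) δ₀ (bb - ρ))
    (hχ1 : ∀ k t, |χ k t| ≤ 1) (hχsupp : ∀ k t, χ k t ≠ 0 → ιB t ∈ Sχ k)
    (hh : ∀ k t, |h k t| ≤ 1) (hS : ∀ k t, h k t ≠ 0 → ιB t ∈ S k)
    (hcnt : ∀ a : (geo9K i).Site, (∑ k, if a ∈ S k then (1 : ℝ) else 0) ≤ N)
    (hD : ∀ k, HasMajorant (g := toB6 (geo9K i) Rr Hp) (fun p : BlkY i × ι => ιB p.1)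
      (conj b (s' • ((cutMulY (𝔸 := 𝔸) (fun t : BlkY i => if ιB t ∈ Sχ k then (1 : ℝ) else 0)).restrictScalars ℝ * (L - Lloc k) *
        (cutMulY (𝔸 := 𝔸) (fun t : BlkY i => if ιB t ∈ S k then (1 : ℝ) else 0)).restrictScalars ℝ)))
      (fun a a'' => κD * Real.exp (-(2 * δ₀ * Dsep)) * (P a)⁻¹ * Real.exp (-(aD * δ₀ * (geo9K i).dist a a''))))
    (hC : ∀ k, HasMajorant (g := toB6 (geo9K i) Rr Hp) (fun p : BlkY i × ι => ιB p.1) (conj b (s • Cl k))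
      (fun a a' => B₀ * P a * Real.exp (-(bb * δ₀ * (geo9K i).dist a a')))) :
    HasMajorant (g := toB6 (geo9K i) Rr Hp) (fun p : BlkY i × ι => ιB p.1)
      (conj b (-(∑ k, (cutMulY (𝔸 := 𝔸) (χ k)).restrictScalars ℝ * (L - Lloc k) *
        ((cutMulY (𝔸 := 𝔸) (h k)).restrictScalars ℝ * Cl k * (cutMulY (𝔸 := 𝔸) (h k)).restrictScalars ℝ))))
      (fun a a' => (N * (κD * Real.exp (-(2 * δ₀ * Dsep)) * B₀ * C * B6.c1 d' δ₀ (bb - ρ))) *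
        Real.exp (-(ρ * δ₀ * (geo9K i).dist a a'))) := by
  rw [conj_neg]
  refine hasMajorant_neg (g := geo9K i) (R := Rr) (H := Hp) _ ?_
  rw [conj_sum]
  -- the □-term in real coordinates, then the two characteristic localizations inserted (`supp χ_□ ⊂ S^χ_□`, `supp h_□ ⊂ S_□`)
  have hterm : ∀ k, conj b ((cutMulY (𝔸 := 𝔸) (χ k)).restrictScalars ℝ * (L - Lloc k) *
      ((cutMulY (𝔸 := 𝔸) (h k)).restrictScalars ℝ * Cl k * (cutMulY (𝔸 := 𝔸) (h k)).restrictScalars ℝ)) =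
      mulOp (fun p : BlkY i × ι => χ k p.1) *
        (mulOp (fun p : BlkY i × ι => if ιB p.1 ∈ Sχ k then (1 : ℝ) else 0) * conj b (s' • (L - Lloc k)) *
          mulOp (fun p : BlkY i × ι => if ιB p.1 ∈ S k then (1 : ℝ) else 0)) *
        (mulOp (fun p : BlkY i × ι => h k p.1) * conj b (s • Cl k) * mulOp (fun p : BlkY i × ι => h k p.1)) := fun k => by
    rw [conj_term2 b hs (χ k) (h k) (L - Lloc k) (Cl k)]
    exact term2_word_loc _ _ _ _ _ _ (fun p hp => if_pos (hχsupp k p.1 hp)) (fun p hp => if_pos (hS k p.1 hp))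
  rw [Finset.sum_congr rfl fun k _ => hterm k]
  -- the displayed localized difference letter, in FILE 5a's currency
  have hD' : ∀ k, HasMajorant (g := toB6 (geo9K i) Rr Hp) (fun p : BlkY i × ι => ιB p.1)
      (mulOp (fun p : BlkY i × ι => if ιB p.1 ∈ Sχ k then (1 : ℝ) else 0) * conj b (s' • (L - Lloc k)) *
        mulOp (fun p : BlkY i × ι => if ιB p.1 ∈ S k then (1 : ℝ) else 0))
      (fun a a'' => κD * Real.exp (-(2 * δ₀ * Dsep)) * (P a)⁻¹ * Real.exp (-(aD * δ₀ * (geo9K i).dist a a''))) := fun k => by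
    rw [← conj_cut_sandwich b s' (fun t : BlkY i => if ιB t ∈ Sχ k then (1 : ℝ) else 0) (fun t : BlkY i => if ιB t ∈ S k then (1 : ℝ) else 0)
      (L - Lloc k)]
    exact hD k
  have h5a := B9Thm39CinvSmallSums.secondSum_majorant_blk (g := geo9K i) (X := BlkY i × ι) (R := Rr) (H := Hp) (fun p : BlkY i × ι => ιB p.1) d' δ₀ aD
    αst ρ bb κD Dsep B₀ C N P S (fun k (p : BlkY i × ι) => χ k p.1) (fun k (p : BlkY i × ι) => h k p.1) hκD hB₀ hC0 hP hδ₀ hρ hsplit htri hsymm hdnn hST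
    h261 (fun k p => hχ1 k p.1) (fun k p => hh k p.1) (fun k p hp => hS k p.1 hp) hcnt
    (fun k => mulOp (fun p : BlkY i × ι => if ιB p.1 ∈ Sχ k then (1 : ℝ) else 0) * conj b (s' • (L - Lloc k)) *
      mulOp (fun p : BlkY i × ι => if ιB p.1 ∈ S k then (1 : ℝ) else 0))
    (fun k => conj b (s • Cl k)) hD' hC
  exact hasMajorant_mono (g := toB6 (geo9K i) Rr Hp) _ h5a fun a a' => le_of_eq (by ring)

omit [CompleteSpace 𝔸] [DecidableEq ι] in
/-- ★★ **THE THIRD SUM OF (3.95) IS (2.85)-SMALL — FILE 1's `hR₃`, from the UN-localized (3.48) blocks of the `C_□`** («terms in the third sum … are already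
localized and give small factors O(M⁻¹)»): as FILE 5b's `hR₃_of_cubes`, with `hC : conj b (s•C_□) ≺ B₀P(a)e^{−bδ₀d(a,a′)}` for all `a, a′`: majorant `θ₃e^{−ρδ₀d}`,
`θ₃ = N·(ℓ₀ + ℓ₁(α_cδ₀)⁻¹)κB₀Cc₁(δ₀, b−ρ)`. [cite: Balaban1985BackgroundPropagators, (3.95) p.411 + p.412; Balaban1984PropagatorsII, (2.84)–(2.85) p.238] -/
theorem hR₃_of_cubes' (d' : ℕ) {δ₀ aL αc αst ρ bb κ ℓ₀ ℓ₁ B₀ C N s s' : ℝ} (P : (geo9K i).Site → ℝ)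
    {κι : Type} [Fintype κι] (S : κι → Finset (geo9K i).Site) (χ h : κι → BlkY i → ℝ)
    (Lloc Cl : κι → Module.End ℝ (BlkY i → 𝔸))
    (hs : s' * s = 1) (hκ : 0 ≤ κ) (hℓ₀ : 0 ≤ ℓ₀) (hℓ₁ : 0 ≤ ℓ₁) (hB₀ : 0 ≤ B₀) (hC0 : 0 ≤ C) (hP : ∀ a, 0 < P a) (hδ₀ : 0 ≤ δ₀)
    (hαc : 0 < αc * δ₀) (hρ : 0 ≤ ρ) (hsplit : αst + αc + ρ ≤ aL)
    (htri : Triangle254 (toB6 (geo9K i) Rr Hp)) (hsymm : ∀ a a' : (geo9K i).Site, (geo9K i).dist a a' = (geo9K i).dist a' a)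
    (hdnn : ∀ a a' : (geo9K i).Site, 0 ≤ (geo9K i).dist a a')
    (hST : B9Ineq347.ScaleTransfer (geo9K i) δ₀ αst C P) (h261 : Ineq261 d' (toB6 (geo9K i) Rr Hp) δ₀ (bb - ρ))
    (hχ1 : ∀ k t, |χ k t| ≤ 1) (hh : ∀ k t, |h k t| ≤ 1) (hS : ∀ k t, h k t ≠ 0 → ιB t ∈ S k)
    (hLip : ∀ k (t t' : BlkY i), |h k t' - h k t| ≤ ℓ₀ + ℓ₁ * (geo9K i).dist (ιB t) (ιB t'))
    (hcnt : ∀ a : (geo9K i).Site, (∑ k, if a ∈ S k then (1 : ℝ) else 0) ≤ N)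
    (hLloc : ∀ k, HasMajorant (g := toB6 (geo9K i) Rr Hp) (fun p : BlkY i × ι => ιB p.1) (conj b (s' • Lloc k))
      (fun a a'' => κ * (P a)⁻¹ * Real.exp (-(aL * δ₀ * (geo9K i).dist a a''))))
    (hC : ∀ k, HasMajorant (g := toB6 (geo9K i) Rr Hp) (fun p : BlkY i × ι => ιB p.1) (conj b (s • Cl k))
      (fun a a' => B₀ * P a * Real.exp (-(bb * δ₀ * (geo9K i).dist a a')))) :
    HasMajorant (g := toB6 (geo9K i) Rr Hp) (fun p : BlkY i × ι => ιB p.1)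
      (conj b (-(∑ k, ((cutMulY (𝔸 := 𝔸) (χ k)).restrictScalars ℝ * Lloc k * (cutMulY (𝔸 := 𝔸) (h k)).restrictScalars ℝ -
        (cutMulY (𝔸 := 𝔸) (h k)).restrictScalars ℝ * ((cutMulY (𝔸 := 𝔸) (χ k)).restrictScalars ℝ * Lloc k)) * Cl k *
        (cutMulY (𝔸 := 𝔸) (h k)).restrictScalars ℝ)))
      (fun a a' => (N * ((ℓ₀ + ℓ₁ * (αc * δ₀)⁻¹) * κ * B₀ * C * B6.c1 d' δ₀ (bb - ρ))) *
        Real.exp (-(ρ * δ₀ * (geo9K i).dist a a'))) := by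
  rw [conj_neg]
  refine hasMajorant_neg (g := geo9K i) (R := Rr) (H := Hp) _ ?_
  rw [conj_sum]
  have hterm : ∀ k, conj b (((cutMulY (𝔸 := 𝔸) (χ k)).restrictScalars ℝ * Lloc k * (cutMulY (𝔸 := 𝔸) (h k)).restrictScalars ℝ -
        (cutMulY (𝔸 := 𝔸) (h k)).restrictScalars ℝ * ((cutMulY (𝔸 := 𝔸) (χ k)).restrictScalars ℝ * Lloc k)) * Cl k *
        (cutMulY (𝔸 := 𝔸) (h k)).restrictScalars ℝ) =
      (mulOp (fun p : BlkY i × ι => χ k p.1) * conj b (s' • Lloc k) * mulOp (fun p : BlkY i × ι => h k p.1) -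
        mulOp (fun p : BlkY i × ι => h k p.1) * (mulOp (fun p : BlkY i × ι => χ k p.1) * conj b (s' • Lloc k))) * conj b (s • Cl k) *
        mulOp (fun p : BlkY i × ι => h k p.1) :=
    fun k => conj_term3 b hs (χ k) (h k) (Lloc k) (Cl k)
  rw [Finset.sum_congr rfl fun k _ => hterm k]
  have h5a := B9Thm39CinvSmallSums.thirdSum_majorant_blk (g := geo9K i) (X := BlkY i × ι) (R := Rr) (H := Hp) (fun p : BlkY i × ι => ιB p.1) d' δ₀ aL
    αc αst ρ bb κ ℓ₀ ℓ₁ B₀ C N P S (fun k (p : BlkY i × ι) => χ k p.1) (fun k (p : BlkY i × ι) => h k p.1) hκ hℓ₀ hℓ₁ hB₀ hC0 hP hδ₀ hαc hρ hsplit htri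
    hsymm hdnn hST h261 (fun k p => hχ1 k p.1) (fun k p => hh k p.1) (fun k p hp => hS k p.1 hp) (fun k p p' => by exact hLip k p.1 p'.1) hcnt
    (fun k => conj b (s' • Lloc k)) (fun k => conj b (s • Cl k)) hLloc hC
  exact hasMajorant_mono (g := toB6 (geo9K i) Rr Hp) _ h5a fun a a' => le_of_eq (by ring)

end Sums

/-! ## §3 ★★ FILE 1's glue (3.95) + `T·L = 1` ⇒ the (3.48)-shape majorant of `conj b (s•C(U))`, with the un-localized `hC` -/

section Glue

variable [DecidableEq ι] [Fintype (geo9K i).Site] [DecidableEq (geo9K i).Site] {Rr : ℝ} {Hp : Prop}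
variable (ιB : BlkY i → IBondY i)

omit [CompleteSpace 𝔸] in
/-- ★★ **THEOREM 3.9 ⇒ THEOREM 3.2's (3.48) BLOCK FOR `C(U)`, FROM THE CUBE DATA — FILE 1 §4 with the UN-localized per-cube blocks** (p. 413 «This theorem
implies Theorem 3.2»; p. 411 (3.95)–(3.96)): letters `L`, `T` with `T·L = 1`; block cut-offs `h_□` (`|h_□| ≦ 1`, `supp h_□ ⊂ S_□` through `ιB`, `Σh_□² = 1`,
overlap `≦ N`); local letters `Chi_□`, `L_□`, `C_□` with the local inverse property; per-cube (3.48) blocks `A·P(a)e^{−r·d(a,a′)}` of `conj b (s•C_□)` for ALL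
`a, a′` (`hC`); the three sums of (3.95) with (2.85)-shape majorants `θ_m e^{−r·d}`; [4] Lemma 2.1 at `(r, α′)`, `(θ₁+θ₂+θ₃)c₁ < 1` ⟹ `conj b (s•T)` has the
majorant `N·A·c₁(1 − (θ₁+θ₂+θ₃)c₁)⁻¹·P(a)·e^{−(1−α′)r·d(a,a′)}`.
[cite: Balaban1985BackgroundPropagators, Thm 3.9 p.413 + (3.95)–(3.96) p.411 + (3.87) p.409 + Thm 3.2 (3.48) p.398; Balaban1984PropagatorsII, (2.66) p.234] -/
theorem hasMajorant_conj_Cinv_of_cubes' (d' : ℕ) {r α' θ₁ θ₂ θ₃ A N : ℝ} (P : (geo9K i).Site → ℝ) (s : ℝ)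
    {κ : Type} [Fintype κ] (S : κ → Finset (geo9K i).Site) (h : κ → BlkY i → ℝ)
    {L T : Module.End ℝ (BlkY i → 𝔸)} (Chi Cl Lloc : κ → Module.End ℝ (BlkY i → 𝔸))
    (hA : 0 ≤ A) (hP : ∀ a, 0 ≤ P a) (hN : 0 ≤ N) (hθ₁ : 0 ≤ θ₁) (hθ₂ : 0 ≤ θ₂) (hθ₃ : 0 ≤ θ₃) (hαr : 0 ≤ (1 - α') * r)
    (htri : Triangle254 (toB6 (geo9K i) Rr Hp)) (hrefl : ∀ y : (geo9K i).Site, (geo9K i).dist y y = 0)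
    (hdnn : ∀ y y' : (geo9K i).Site, 0 ≤ (geo9K i).dist y y')
    (h261 : Ineq261 d' (toB6 (geo9K i) Rr Hp) r α') (h263 : Ineq263 d' (toB6 (geo9K i) Rr Hp) r α')
    (hsmall : (θ₁ + θ₂ + θ₃) * B6.c1 d' r α' < 1)
    (hinv : T * L = 1) (hsq : ∀ t, ∑ k, h k t ^ 2 = 1) (hh : ∀ k t, |h k t| ≤ 1) (hS : ∀ k t, h k t ≠ 0 → ιB t ∈ S k)
    (hcnt : ∀ a : (geo9K i).Site, (∑ k, if a ∈ S k then (1 : ℝ) else 0) ≤ N)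
    (hloc : ∀ k, (cutMulY (𝔸 := 𝔸) (h k)).restrictScalars ℝ * (Chi k * Lloc k) * Cl k * (cutMulY (𝔸 := 𝔸) (h k)).restrictScalars ℝ
      = (cutMulY (𝔸 := 𝔸) (h k)).restrictScalars ℝ * (cutMulY (𝔸 := 𝔸) (h k)).restrictScalars ℝ)
    (hC : ∀ k, HasMajorant (g := toB6 (geo9K i) Rr Hp) (fun p : BlkY i × ι => ιB p.1) (conj b (s • Cl k))
      (fun a a' => A * P a * Real.exp (-(r * (geo9K i).dist a a'))))
    (hR₁ : HasMajorant (g := toB6 (geo9K i) Rr Hp) (fun p : BlkY i × ι => ιB p.1)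
      (conj b (-(∑ k, (1 - Chi k) * L * ((cutMulY (𝔸 := 𝔸) (h k)).restrictScalars ℝ * Cl k * (cutMulY (𝔸 := 𝔸) (h k)).restrictScalars ℝ))))
      (fun a a' => θ₁ * Real.exp (-(r * (geo9K i).dist a a'))))
    (hR₂ : HasMajorant (g := toB6 (geo9K i) Rr Hp) (fun p : BlkY i × ι => ιB p.1)
      (conj b (-(∑ k, Chi k * (L - Lloc k) * ((cutMulY (𝔸 := 𝔸) (h k)).restrictScalars ℝ * Cl k * (cutMulY (𝔸 := 𝔸) (h k)).restrictScalars ℝ))))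
      (fun a a' => θ₂ * Real.exp (-(r * (geo9K i).dist a a'))))
    (hR₃ : HasMajorant (g := toB6 (geo9K i) Rr Hp) (fun p : BlkY i × ι => ιB p.1)
      (conj b (-(∑ k, (Chi k * Lloc k * (cutMulY (𝔸 := 𝔸) (h k)).restrictScalars ℝ -
        (cutMulY (𝔸 := 𝔸) (h k)).restrictScalars ℝ * (Chi k * Lloc k)) * Cl k * (cutMulY (𝔸 := 𝔸) (h k)).restrictScalars ℝ)))
      (fun a a' => θ₃ * Real.exp (-(r * (geo9K i).dist a a')))) :
    HasMajorant (g := toB6 (geo9K i) Rr Hp) (fun p : BlkY i × ι => ιB p.1) (conj b (s • T))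
      (fun a a' => N * A * B6.c1 d' r α' * (1 - (θ₁ + θ₂ + θ₃) * B6.c1 d' r α')⁻¹ * P a *
        Real.exp (-((1 - α') * r * (geo9K i).dist a a'))) := by
  have h395 := B9Thm39CinvTorusRegular.eq395_cutoffs L h hsq Chi Cl Lloc hloc
  have hRop : -(∑ k, (1 - Chi k) * L * ((cutMulY (𝔸 := 𝔸) (h k)).restrictScalars ℝ * Cl k * (cutMulY (𝔸 := 𝔸) (h k)).restrictScalars ℝ) +
        ∑ k, Chi k * (L - Lloc k) * ((cutMulY (𝔸 := 𝔸) (h k)).restrictScalars ℝ * Cl k * (cutMulY (𝔸 := 𝔸) (h k)).restrictScalars ℝ) +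
        ∑ k, (Chi k * Lloc k * (cutMulY (𝔸 := 𝔸) (h k)).restrictScalars ℝ - (cutMulY (𝔸 := 𝔸) (h k)).restrictScalars ℝ * (Chi k * Lloc k)) * Cl k *
          (cutMulY (𝔸 := 𝔸) (h k)).restrictScalars ℝ)
      = -(∑ k, (1 - Chi k) * L * ((cutMulY (𝔸 := 𝔸) (h k)).restrictScalars ℝ * Cl k * (cutMulY (𝔸 := 𝔸) (h k)).restrictScalars ℝ)) +
        -(∑ k, Chi k * (L - Lloc k) * ((cutMulY (𝔸 := 𝔸) (h k)).restrictScalars ℝ * Cl k * (cutMulY (𝔸 := 𝔸) (h k)).restrictScalars ℝ)) +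
        -(∑ k, (Chi k * Lloc k * (cutMulY (𝔸 := 𝔸) (h k)).restrictScalars ℝ - (cutMulY (𝔸 := 𝔸) (h k)).restrictScalars ℝ * (Chi k * Lloc k)) * Cl k *
          (cutMulY (𝔸 := 𝔸) (h k)).restrictScalars ℝ) := by
    abel
  rw [hRop] at h395
  have hC0 := hasMajorant_conj_C0_of_cubes i b (Rr := Rr) (Hp := Hp) ιB S h Cl s
    (K := fun a a' => A * P a * Real.exp (-(r * (geo9K i).dist a a')))
    (fun a a' => mul_nonneg (mul_nonneg hA (hP a)) (Real.exp_nonneg _)) hh hS hC hcnt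
  have hmaj := hasMajorant_conj_Cinv_of_395 i b ιB d' P s (A := N * A) (θ := θ₁ + θ₂ + θ₃) (mul_nonneg hN hA) hP
    (add_nonneg (add_nonneg hθ₁ hθ₂) hθ₃) hαr htri hrefl hdnn h261 h263 hsmall hinv h395
    (hasMajorant_mono (g := toB6 (geo9K i) Rr Hp) _ hC0 fun a a' => le_of_eq (by ring)) (hasMajorant_three i b ιB hR₁ hR₂ hR₃)
  exact hasMajorant_mono (g := toB6 (geo9K i) Rr Hp) _ hmaj fun a a' => le_of_eq (by ring)

end Glue

end Literature.MathematicalPhysics.QuantumFieldTheory.Balaban1983to89.B9Thm39CinvSumsYLoc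

end
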